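import Mathlib
import HarnessLib
import Literature.Analysis.FluidPDE.TaoAveragedNoDilClosure
import Literature.Analysis.FluidPDE.TaoAveragedCascadeStepsProofs
import Literature.Analysis.FluidPDE.TaoAveragedSingleScaleAt
import Summits.NavierStokesRegularity.NavierStokesRegularity.Theses.TaoLadderRungOne

/-!
# Stub `stub_splitNoDilPackaging` (= child item `SplitNoDilPackaging`, stmt-NavierStokesRegularity-20434)
# of the crux R1-a `SplitCascadeIsAveragedNoDil` (route TaoLadderRungOne)

T. Tao, *Finite time blowup for an averaged three-dimensional Navier–Stokes equation*, J. Amer. Math.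
Soc. **29** (2016), 601–674 = arXiv:1402.0290v3, §3.1–§3.2 pp. 15–16 ("by decomposing the `ψⱼ` …
into finitely many (complex-valued) pieces … due to the presence of rotations and dilations in the
definition of a complex average, we have the freedom to rotate and dilate each of the `ξⱼ⁰` as we
please"), Remark 3.5 p. 20.
HONEST FRAMING (cell harvest/h2-tao-ladder, TAO-LADDER rung M_1; RUBRIC D4): MODEL statements about
Tao's local cascade class and his averaging data. This file proves the registered stub
`stub_splitNoDilPackaging : SplitNoDilPackaging` of the skeleton
`Cruxes/SplitCascadeIsAveragedNoDil/…/SplitCascadeIsAveragedNoDil_split.lean` (theory-1 g8): the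
PACKAGING implication «dilation-free Theorem 3.2♭ for complexified basic forms with profiles
normalised about EVERY closed base triangle with sides in `[4/5, 3/2]` and input gap `≥ κε₀` ⇒ the
crux `SplitCascadeIsAveragedNoDil`». It does NOT prove the single-scale core (items 20432/20433) and
says nothing about the true Navier–Stokes equations.

PROOF (§3.2 ¶2 with ROTATIONS ONLY, then §3.1/§3.2 ¶1 with `λ ≡ 1`). Given a split local cascade form
`T = ∑ⱼ cⱼ ⟨Cⱼ⟩` (profiles with annular Fourier support inside balls of radius `ε₀/64` about `±ζⱼᵢ`,
input gap `|‖ζⱼ₁‖ - ‖ζⱼ₂‖| ≥ ε₀/20`), the tree's `Tao2016.isAveragedNoDil_of_basicNoDil`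
(`TaoAveragedNoDilClosure.lean`) reduces to ONE basic form. For it: cut the three profiles into complex
pieces of Fourier radius `r = ε₀³/4` with a partition of unity on the annulus
(`exists_annulus_partition`, `freqPiece`); a piece whose centre modulus is farther than `r + ε₀/64`
from `‖ζᵢ‖` has identically vanishing Fourier transform (`fourier_freqPiece` and the ball support of
`ψᵢ`), so EVERY piece of slot `i` is supported in a ball of radius `r` about a centre of modulus
`mᵢ ∈ [4/5, 3/2]` with `mᵢ` within `r + ε₀/64` of `‖ζᵢ‖` (near pieces) or `mᵢ ∈ {4/5, 3/2, 1}` (far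
pieces, re-centred; their support condition is vacuous); hence the two input moduli of every piece
triple differ by `≥ ε₀/64` (`ε₀ ≤ 1/16`). Rotate each slot (NO dilation: the target has the same
modulus) onto a closed triangle with side lengths `(m₀, m₁, m₂)` (`exists_closedTriangle`, planar law
of cosines), apply the hypothesis with `κ = 1/64`, and conjugate back
(`exists_normalising_rotDil` with ratio `1`, `cplxBasicCascadeForm_transport`, precomposition keeps
`λ ≡ 1`); sum the piece triples (`basicCascadeForm_eq_sum_pieces`,
`isComplexAverageNoDilOf_sum_eulerForm`).

## References
* T. Tao, J. Amer. Math. Soc. 29 (2016), 601–674 = arXiv:1402.0290v3, §3.1–3.2, Remark 3.5.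
  [`Tao2016AveragedNS`]
-/

noncomputable section

-- the sub-problem namespace `Summit.NavierStokesRegularity.NavierStokesRegularity` repeats the summit name by design (D-0017)
set_option linter.dupNamespace false

namespace Summit.NavierStokesRegularity.NavierStokesRegularity.Theorems.SplitCascadeIsAveragedNoDil.Split

open MeasureTheory Set
open scoped SchwartzMap FourierTransform
open Literature.Analysis.FluidPDE Literature.Analysis.FluidPDE.Tao2016
open Summit.NavierStokesRegularity.NavierStokesRegularity.Theses.TaoLadderRungOne

/-! ## Dilation-free bookkeeping for conjugation by per-slot rotations -/

/-- **Conjugating a DILATION-FREE complex average by per-slot rotations and trivial dilation factors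
`κᵢ = 1` gives a dilation-free complex average** (the precomposed datum has dilation factors
`λ·κ = 1`). [cite: Tao2016AveragedNS, §3.2 p. 15] -/
theorem isComplexAverageNoDilOf_precomp {C C' : L2C → L2C → L2C → ℂ}
    (h : IsComplexAverageNoDilOf C C')
    (Rf : Fin 3 → (EuclideanSpace ℝ (Fin 3) ≃ₗᵢ[ℝ] EuclideanSpace ℝ (Fin 3))) (κ : Fin 3 → ℝ)
    (hRf : ∀ i, LinearMap.det ((Rf i).toLinearEquiv :
      EuclideanSpace ℝ (Fin 3) →ₗ[ℝ] EuclideanSpace ℝ (Fin 3)) = 1)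
    (hκ : ∀ i, 0 < κ i) (hκ1 : ∀ i, κ i = 1) :
    IsComplexAverageNoDilOf (fun u v w => C (rot (Rf 0) (dil (κ 0) u)) (rot (Rf 1) (dil (κ 1) v))
      (rot (Rf 2) (dil (κ 2) w))) C' := by
  obtain ⟨𝒟, hlam, h𝒟⟩ := h
  refine ⟨𝒟.precomp Rf κ hRf hκ, fun i θ => ?_, fun u v w hu hv hw => ?_⟩
  · change 𝒟.lam i θ * κ i = 1
    rw [hlam, hκ1, one_mul]
  · rw [𝒟.precomp_average]
    exact h𝒟 _ _ _ ((hu.dil (hκ 0)).rot _) ((hv.dil (hκ 1)).rot _) ((hw.dil (hκ 2)).rot _)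

/-- A form that agrees on `H¹⁰_df ⊗ ℂ` with a dilation-free complex average of `C'` is one.
[cite: Tao2016AveragedNS, Def. 3.4] -/
theorem isComplexAverageNoDilOf_of_eqOn {C₁ C₂ C' : L2C → L2C → L2C → ℂ}
    (h : IsComplexAverageNoDilOf C₂ C')
    (heq : ∀ u v w, MemH10dfC u → MemH10dfC v → MemH10dfC w → C₁ u v w = C₂ u v w) :
    IsComplexAverageNoDilOf C₁ C' := by
  obtain ⟨𝒟, hlam, h𝒟⟩ := h
  exact ⟨𝒟, hlam, fun u v w hu hv hw => (heq u v w hu hv hw).trans (h𝒟 u v w hu hv hw)⟩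

/-! ## A closed triangle with prescribed side lengths in `[4/5, 3/2]` -/

/-- **Planar law of cosines**: for side lengths `m₀, m₁, m₂ ∈ [4/5, 3/2]` (so that every triangle
inequality holds strictly) there are `ξ₀, ξ₁, ξ₂ ∈ ℝ³` with `ξ₀ + ξ₁ + ξ₂ = 0` and `‖ξᵢ‖ = mᵢ`.
[folklore] -/
theorem exists_closedTriangle (m : Fin 3 → ℝ) (hm : ∀ i, 4 / 5 ≤ m i ∧ m i ≤ 3 / 2) :
    ∃ ξ : Fin 3 → EuclideanSpace ℝ (Fin 3), ξ 0 + ξ 1 + ξ 2 = 0 ∧ ∀ i, ‖ξ i‖ = m i := by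
  obtain ⟨ha1, ha2⟩ := hm 0
  obtain ⟨hb1, hb2⟩ := hm 1
  obtain ⟨hc1, hc2⟩ := hm 2
  set a := m 0 with ha
  set b := m 1 with hb
  set c := m 2 with hc
  have ha0 : 0 < a := by linarith
  -- `x = (c² - a² - b²)/(2a)`, `y = √(b² - x²)`
  set x : ℝ := (c ^ 2 - a ^ 2 - b ^ 2) / (2 * a) with hx
  have h2ax : 2 * a * x = c ^ 2 - a ^ 2 - b ^ 2 := by
    rw [hx]; field_simp
  have hxb : x ^ 2 ≤ b ^ 2 := by
    -- `|c² - a² - b²| ≤ 2ab` from `|a - b| ≤ c ≤ a + b`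
    have h1 : c ^ 2 - a ^ 2 - b ^ 2 ≤ 2 * a * b := by nlinarith
    have h2 : -(2 * a * b) ≤ c ^ 2 - a ^ 2 - b ^ 2 := by nlinarith
    have hx1 : x ≤ b := by
      rw [hx, div_le_iff₀ (by linarith)]; linarith
    have hx2 : -b ≤ x := by
      rw [hx, le_div_iff₀ (by linarith)]; linarith
    nlinarith
  set y : ℝ := Real.sqrt (b ^ 2 - x ^ 2) with hy
  have hy2 : y ^ 2 = b ^ 2 - x ^ 2 := Real.sq_sqrt (by linarith)
  refine ⟨![!₂[a, 0, 0], !₂[x, y, 0], !₂[-a - x, -y, 0]], ?_, fun i => ?_⟩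
  · ext i
    fin_cases i <;> simp
  · fin_cases i
    · show ‖(!₂[a, 0, 0] : EuclideanSpace ℝ (Fin 3))‖ = a
      rw [EuclideanSpace.norm_eq]
      simp [Fin.sum_univ_three]
      exact Real.sqrt_sq ha0.le
    · show ‖(!₂[x, y, 0] : EuclideanSpace ℝ (Fin 3))‖ = b
      rw [EuclideanSpace.norm_eq]
      simp [Fin.sum_univ_three]
      rw [show x ^ 2 + y ^ 2 = b ^ 2 by rw [hy2]; ring]
      exact Real.sqrt_sq (by linarith)
    · show ‖(!₂[-a - x, -y, 0] : EuclideanSpace ℝ (Fin 3))‖ = c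
      rw [EuclideanSpace.norm_eq]
      simp [Fin.sum_univ_three]
      convert Real.sqrt_sq (show (0 : ℝ) ≤ c by linarith) using 2
      linear_combination hy2 + h2ax

/-! ## §3.2 ¶2 with rotations only: one basic split form -/

set_option maxHeartbeats 800000 in
/-- **The dilation-free Theorem 3.2♭ for ONE basic split form, from the single-form core at closed
base triangles.** Let `0 < ε₀ ≤ min ε₁ (1/16)` and suppose that for every closed triangle `ξ` with
sides in `[4/5, 3/2]` and input gap `≥ ε₀/64`, every complexified basic form with profiles normalised
about `ξ` (`ψ̂ⱼ ⊆ B(ξⱼ, ε₀³)`) is a dilation-free complex average of `B`. Then every basic cascade form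
whose (real, annular) profiles have Fourier support in balls of radius `ε₀/64` about `±ζᵢ` with
`|‖ζ₀‖ - ‖ζ₁‖| ≥ ε₀/20` is a dilation-free complex average of `B`. [cite: Tao2016AveragedNS, §3.2 pp. 15–16] -/
theorem basicSplitForm_noDil {ε₀ ε₁ : ℝ} (hε₀ : 0 < ε₀) (hle₁ : ε₀ ≤ ε₁) (hle : ε₀ ≤ 1 / 16)
    (H : ∀ ε : ℝ, 0 < ε → ε ≤ ε₁ → ∀ ξ : Fin 3 → EuclideanSpace ℝ (Fin 3), ξ 0 + ξ 1 + ξ 2 = 0 →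
      (∀ j, 4 / 5 ≤ ‖ξ j‖ ∧ ‖ξ j‖ ≤ 3 / 2) → 1 / 64 * ε ≤ |‖ξ 0‖ - ‖ξ 1‖| →
      ∀ φ : Fin 3 → 𝓢(EuclideanSpace ℝ (Fin 3), EuclideanSpace ℂ (Fin 3)),
        NormalisedProfilesAt ξ ε φ →
          IsComplexAverageNoDilOf (cplxBasicCascadeForm ε (φ 0) (φ 1) (φ 2)) eulerForm)
    (ψ : Fin 3 → 𝓢(EuclideanSpace ℝ (Fin 3), EuclideanSpace ℝ (Fin 3)))
    (ζ : Fin 3 → EuclideanSpace ℝ (Fin 3)) (hann : ∀ i, HasAnnularFourierSupport ε₀ (ψ i))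
    (hball : ∀ i, ∀ ξ : EuclideanSpace ℝ (Fin 3), ε₀ / 64 < dist ξ (ζ i) → ε₀ / 64 < dist ξ (-ζ i) →
      𝓕 (Literature.Analysis.FunctionSpaces.EuclideanSpace.complexify ∘ ⇑(ψ i)) ξ = 0)
    (hgap : ε₀ / 20 ≤ |‖ζ 0‖ - ‖ζ 1‖|) :
    IsComplexAverageNoDilOf (basicCascadeForm ε₀ (ψ 0) (ψ 1) (ψ 2)) eulerForm := by
  classical
  have hε : 0 < 1 + ε₀ := by linarith
  -- pieces of radius `r = ε₀³/4`
  set r : ℝ := ε₀ ^ 3 / 4 with hr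
  have hr0 : 0 < r := by positivity
  have hr3 : r ≤ ε₀ ^ 3 := by rw [hr]; linarith [pow_pos hε₀ 3]
  have hrs : r ≤ ε₀ / 1024 := by
    rw [hr]
    have : ε₀ ^ 3 ≤ ε₀ * (1 / 16) ^ 2 := by
      rw [pow_succ, pow_succ, pow_one]
      have h1 : ε₀ * ε₀ ≤ ε₀ * (1 / 16) := by nlinarith
      nlinarith
    nlinarith
  obtain ⟨ι, _, c, χ, hc, hsmooth, hcpt, hsupp, hsum⟩ := exists_annulus_partition ε₀ hr0
  have hχ : ∀ a, (χ a).HasTemperateGrowth := fun a => (hcpt a).hasTemperateGrowth (hsmooth a)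
  set φ : Fin 3 → ι → 𝓢(EuclideanSpace ℝ (Fin 3), EuclideanSpace ℂ (Fin 3)) :=
    fun j a => freqPiece (χ a) (schwartzC (ψ j)) with hφdef
  have hφsum : ∀ j, ∑ a, φ j a = schwartzC (ψ j) := fun j =>
    sum_freqPiece_eq Finset.univ (fun a _ => hχ a) _ fun ξ hξ => hsum ξ (by
      by_contra h
      exact hξ ((hann j).eq_zero_of_not_mem h))
  have hφsupp : ∀ j a, HasBallFourierSupport (c a) r (φ j a) := fun j a =>
    hasBallFourierSupport_freqPiece (hχ a) (hsupp a) _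
  -- geometry of the piece centres
  have hc_mem : ∀ a, 1 - 2 * ε₀ ≤ ‖c a‖ ∧ ‖c a‖ ≤ 1 + 2 * ε₀ := fun a => (mem_freqAnnulus.1 (hc a))
  have hc_pos : ∀ a, 0 < ‖c a‖ := fun a => by linarith [(hc_mem a).1]
  have hc_ne : ∀ a, c a ≠ 0 := fun a => norm_pos_iff.1 (hc_pos a)
  have hρ : ∀ a, 0 < ‖c a‖ - r := fun a => by linarith [(hc_mem a).1]
  -- a FAR piece (centre modulus farther than `r + ε₀/64` from `‖ζ i‖`) has vanishing Fourier transform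
  have hfar : ∀ (i : Fin 3) (a : ι), r + ε₀ / 64 < |‖c a‖ - ‖ζ i‖| →
      ∀ ξ : EuclideanSpace ℝ (Fin 3), 𝓕 (⇑(φ i a)) ξ = 0 := by
    intro i a hfa ξ
    change 𝓕 (⇑(freqPiece (χ a) (schwartzC (ψ i)))) ξ = 0
    rw [fourier_freqPiece (hχ a)]
    by_cases hχ0 : χ a ξ = 0
    · rw [hχ0, zero_smul]
    · have hd : dist ξ (c a) < r := hsupp a ξ hχ0
      have h1 : |‖ξ‖ - ‖c a‖| ≤ dist ξ (c a) := by
        rw [dist_eq_norm]; exact abs_norm_sub_norm_le ξ (c a)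
      have h2 : ε₀ / 64 < |‖ξ‖ - ‖ζ i‖| := by
        have e : ‖c a‖ - ‖ζ i‖ = (‖ξ‖ - ‖ζ i‖) - (‖ξ‖ - ‖c a‖) := by ring
        rw [e] at hfa
        have h3 := abs_sub (‖ξ‖ - ‖ζ i‖) (‖ξ‖ - ‖c a‖)
        linarith
      have hz1 : ε₀ / 64 < dist ξ (ζ i) := by
        have := abs_norm_sub_norm_le ξ (ζ i)
        rw [dist_eq_norm]; linarith
      have hz2 : ε₀ / 64 < dist ξ (-ζ i) := by
        have := abs_norm_sub_norm_le ξ (-ζ i)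
        rw [norm_neg] at this
        rw [dist_eq_norm]; linarith
      have hz := hball i ξ hz1 hz2
      rw [← coe_schwartzC] at hz
      rw [hz, smul_zero]
  -- target moduli: near pieces keep their modulus, far pieces are re-centred on `4/5, 3/2, 1`
  set N : Fin 3 → ℝ := ![4 / 5, 3 / 2, 1] with hN
  set m : Fin 3 → ι → ℝ := fun i a =>
    if |‖c a‖ - ‖ζ i‖| ≤ r + ε₀ / 64 then ‖c a‖ else N i with hm
  have hm_win : ∀ i a, 4 / 5 ≤ m i a ∧ m i a ≤ 3 / 2 := by
    intro i a
    simp only [hm]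
    split_ifs
    · constructor <;> linarith [(hc_mem a).1, (hc_mem a).2]
    · fin_cases i <;> simp [hN] <;> norm_num
  have hm_pos : ∀ i a, 0 < m i a := fun i a => by linarith [(hm_win i a).1]
  -- the input gap of every piece pair
  have hm_gap : ∀ a b : ι, 1 / 64 * ε₀ ≤ |m 0 a - m 1 b| := by
    intro a b
    simp only [hm]
    have hN0 : N 0 = 4 / 5 := rfl
    have hN1 : N 1 = 3 / 2 := rfl
    split_ifs with h0 h1 h1
    · -- both near: gap of the data minus `2(r + ε₀/64)`
      have e : ‖ζ 0‖ - ‖ζ 1‖ = (‖c a‖ - ‖c b‖) - (‖c a‖ - ‖ζ 0‖) + (‖c b‖ - ‖ζ 1‖) := by ring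
      have h3 : |‖ζ 0‖ - ‖ζ 1‖| ≤ |‖c a‖ - ‖c b‖| + |‖c a‖ - ‖ζ 0‖| + |‖c b‖ - ‖ζ 1‖| := by
        rw [e]
        have h4 := abs_add_le (‖c a‖ - ‖c b‖ - (‖c a‖ - ‖ζ 0‖)) (‖c b‖ - ‖ζ 1‖)
        have h5 := abs_sub (‖c a‖ - ‖c b‖) (‖c a‖ - ‖ζ 0‖)
        linarith
      nlinarith [h3, h0, h1, hgap, hrs]
    · rw [hN1]
      have : |‖c a‖ - 3 / 2| = 3 / 2 - ‖c a‖ := by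
        rw [abs_sub_comm]; exact abs_of_nonneg (by linarith [(hc_mem a).2])
      rw [this]; linarith [(hc_mem a).2]
    · rw [hN0]
      have : |4 / 5 - ‖c b‖| = ‖c b‖ - 4 / 5 := by
        rw [abs_sub_comm]; exact abs_of_nonneg (by linarith [(hc_mem b).1])
      rw [this]; linarith [(hc_mem b).1]
    · rw [hN0, hN1]; norm_num; linarith
  -- re-centred centres and their support property
  set ctr : Fin 3 → ι → EuclideanSpace ℝ (Fin 3) := fun i a => (m i a / ‖c a‖) • c a with hctr
  have hctr_norm : ∀ i a, ‖ctr i a‖ = m i a := by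
    intro i a
    simp only [hctr]
    rw [norm_smul, Real.norm_eq_abs, abs_of_pos (div_pos (hm_pos i a) (hc_pos a)),
      div_mul_cancel₀ _ (hc_pos a).ne']
  have hctr_ne : ∀ i a, ctr i a ≠ 0 := fun i a => by
    rw [← norm_pos_iff, hctr_norm]; exact hm_pos i a
  have hctr_supp : ∀ i a, HasBallFourierSupport (ctr i a) r (φ i a) := by
    intro i a
    by_cases hnear : |‖c a‖ - ‖ζ i‖| ≤ r + ε₀ / 64
    · have hmi : m i a = ‖c a‖ := by simp only [hm, hnear, if_true]
      have : ctr i a = c a := by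
        simp only [hctr]; rw [hmi, div_self (hc_pos a).ne', one_smul]
      rw [this]; exact hφsupp i a
    · exact fun ξ _ => hfar i a (lt_of_not_ge hnear) ξ
  -- each piece triple is a dilation-free complex average of `B`
  have hpiece : ∀ abc : ι × ι × ι,
      IsComplexAverageNoDilOf
        (cplxBasicCascadeForm ε₀ (φ 0 abc.1) (φ 1 abc.2.1) (φ 2 abc.2.2)) eulerForm := by
    intro abc
    -- the target closed triangle with the pieces' (re-centred) moduli
    obtain ⟨ξ, hξsum, hξnorm⟩ := exists_closedTriangle
      ![m 0 abc.1, m 1 abc.2.1, m 2 abc.2.2]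
      (fun i => by fin_cases i <;> exact hm_win _ _)
    have hξ0 : ‖ξ 0‖ = m 0 abc.1 := hξnorm 0
    have hξ1 : ‖ξ 1‖ = m 1 abc.2.1 := hξnorm 1
    have hξ2 : ‖ξ 2‖ = m 2 abc.2.2 := hξnorm 2
    have hξne : ∀ i, ξ i ≠ 0 := fun i => by
      rw [← norm_pos_iff, hξnorm i]
      fin_cases i <;> exact hm_pos _ _
    obtain ⟨R₀, φ₀', hdet₀, htoLp₀, hsupp₀⟩ :=
      exists_normalising_rotDil (hctr_ne 0 abc.1) (hξne 0) (φ 0 abc.1) (hctr_supp 0 abc.1)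
    obtain ⟨R₁, φ₁', hdet₁, htoLp₁, hsupp₁⟩ :=
      exists_normalising_rotDil (hctr_ne 1 abc.2.1) (hξne 1) (φ 1 abc.2.1) (hctr_supp 1 abc.2.1)
    obtain ⟨R₂, φ₂', hdet₂, htoLp₂, hsupp₂⟩ :=
      exists_normalising_rotDil (hctr_ne 2 abc.2.2) (hξne 2) (φ 2 abc.2.2) (hctr_supp 2 abc.2.2)
    -- the dilation ratios are `1`
    have hκ0 : ‖ξ 0‖ / ‖ctr 0 abc.1‖ = 1 := by rw [hξ0, hctr_norm, div_self (hm_pos _ _).ne']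
    have hκ1 : ‖ξ 1‖ / ‖ctr 1 abc.2.1‖ = 1 := by rw [hξ1, hctr_norm, div_self (hm_pos _ _).ne']
    have hκ2 : ‖ξ 2‖ / ‖ctr 2 abc.2.2‖ = 1 := by rw [hξ2, hctr_norm, div_self (hm_pos _ _).ne']
    set κ : Fin 3 → ℝ := ![‖ξ 0‖ / ‖ctr 0 abc.1‖, ‖ξ 1‖ / ‖ctr 1 abc.2.1‖, ‖ξ 2‖ / ‖ctr 2 abc.2.2‖]
      with hκ
    have hκone : ∀ i, κ i = 1 := by
      intro i; fin_cases i
      exacts [hκ0, hκ1, hκ2]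
    have hκpos : ∀ i, 0 < κ i := fun i => by rw [hκone i]; exact one_pos
    set Rf : Fin 3 → (EuclideanSpace ℝ (Fin 3) ≃ₗᵢ[ℝ] EuclideanSpace ℝ (Fin 3)) := ![R₀, R₁, R₂]
      with hRf
    have hdet : ∀ i, LinearMap.det ((Rf i).toLinearEquiv :
        EuclideanSpace ℝ (Fin 3) →ₗ[ℝ] EuclideanSpace ℝ (Fin 3)) = 1 := by
      intro i; fin_cases i
      exacts [hdet₀, hdet₁, hdet₂]
    set φ' : Fin 3 → 𝓢(EuclideanSpace ℝ (Fin 3), EuclideanSpace ℂ (Fin 3)) := ![φ₀', φ₁', φ₂']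
      with hφ'
    set φp : Fin 3 → 𝓢(EuclideanSpace ℝ (Fin 3), EuclideanSpace ℂ (Fin 3)) :=
      ![φ 0 abc.1, φ 1 abc.2.1, φ 2 abc.2.2] with hφp
    have htoLp : ∀ i, (φ' i).toLp 2 (volume : Measure (EuclideanSpace ℝ (Fin 3))) =
        rot (Rf i) (dil (κ i) ((φp i).toLp 2 (volume : Measure (EuclideanSpace ℝ (Fin 3))))) := by
      intro i; fin_cases i
      exacts [htoLp₀, htoLp₁, htoLp₂]
    -- the rotated pieces are normalised about `ξ`
    have hnorm' : NormalisedProfilesAt ξ ε₀ φ' := by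
      intro j
      fin_cases j
      · refine hsupp₀.mono ?_
        rw [hκ0, one_mul]; exact hr3
      · refine hsupp₁.mono ?_
        rw [hκ1, one_mul]; exact hr3
      · refine hsupp₂.mono ?_
        rw [hκ2, one_mul]; exact hr3
    have hwin : ∀ j, 4 / 5 ≤ ‖ξ j‖ ∧ ‖ξ j‖ ≤ 3 / 2 := by
      intro j
      rw [hξnorm j]
      fin_cases j <;> exact hm_win _ _
    have hgap' : 1 / 64 * ε₀ ≤ |‖ξ 0‖ - ‖ξ 1‖| := by
      rw [hξ0, hξ1]; exact hm_gap _ _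
    have hH := H ε₀ hε₀ hle₁ ξ hξsum hwin hgap' φ' hnorm'
    have htr := cplxBasicCascadeForm_transport hε φp φ' Rf κ hκpos htoLp
    exact isComplexAverageNoDilOf_of_eqOn (isComplexAverageNoDilOf_precomp hH Rf κ hdet hκpos hκone)
      fun u v w _ _ _ => htr u v w
  -- sum over the piece triples
  have havg := isComplexAverageNoDilOf_sum_eulerForm (Finset.univ : Finset (ι × ι × ι))
    (fun _ => (1 : ℂ))
    (fun abc => cplxBasicCascadeForm ε₀ (φ 0 abc.1) (φ 1 abc.2.1) (φ 2 abc.2.2))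
    fun abc _ => hpiece abc
  refine isComplexAverageNoDilOf_of_eqOn havg fun u v w hu hv hw => ?_
  have hsum : ∀ abc : ι × ι × ι, Summable fun n : ℤ =>
      (((1 + ε₀) ^ ((5 : ℝ) * (n : ℝ) / 2) : ℝ) : ℂ) *
        (pairing u (conjL2 (cplxCascadeWavelet ε₀ (φ 0 abc.1) n)) *
          pairing v (conjL2 (cplxCascadeWavelet ε₀ (φ 1 abc.2.1) n)) *
            pairing w (conjL2 (cplxCascadeWavelet ε₀ (φ 2 abc.2.2) n))) := fun abc =>
    summable_cplxCascade_term hε₀ _ _ (hρ abc.1)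
      ((hφsupp 0 abc.1).eq_zero_of_norm_lt) hu.1 v w
  calc basicCascadeForm ε₀ (ψ 0) (ψ 1) (ψ 2) u v w
      = ∑ abc : ι × ι × ι,
          cplxBasicCascadeForm ε₀ (φ 0 abc.1) (φ 1 abc.2.1) (φ 2 abc.2.2) u v w :=
        basicCascadeForm_eq_sum_pieces ψ φ hφsum hsum
    _ = ∑ abc : ι × ι × ι,
          (1 : ℂ) * cplxBasicCascadeForm ε₀ (φ 0 abc.1) (φ 1 abc.2.1) (φ 2 abc.2.2) u v w := by
        simp only [one_mul]

/-! ## The registered stub -/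

/-- **STUB `stub_splitNoDilPackaging` (PROVED, registered signature = child item
`SplitNoDilPackaging`, stmt-NavierStokesRegularity-20434).** The dilation-free Theorem 3.2♭ for
complexified basic forms about every gapped closed base triangle implies the crux
`SplitCascadeIsAveragedNoDil`: for `ε₀ ≤ min ε₁(1/64) (1/16)`, reduce a split local cascade form to one
basic form (`Tao2016.isAveragedNoDil_of_basicNoDil`: finite sums, realness, §3.1 with `λ ≡ 1`,
`ℂ`-linearity) and package that form by rotations only (`basicSplitForm_noDil`).
[cite: Tao2016AveragedNS, §3.1–3.2 pp. 15–16, Remark 3.5 p. 20] -/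
theorem stub_splitNoDilPackaging : SplitNoDilPackaging := by
  intro Hcore
  obtain ⟨ε₁, hε₁, H⟩ := Hcore (1 / 64) (by norm_num)
  refine ⟨min ε₁ (1 / 16), lt_min hε₁ (by norm_num), fun ε₀ hε₀ hle T hT => ?_⟩
  obtain ⟨k, c, ψ, ζ, hann, hball, hgap, hT⟩ := hT
  exact isAveragedNoDil_of_basicNoDil
    (P := fun φ => ∃ z : Fin 3 → EuclideanSpace ℝ (Fin 3),
      (∀ i, HasAnnularFourierSupport ε₀ (φ i)) ∧
      (∀ i, ∀ ξ : EuclideanSpace ℝ (Fin 3), ε₀ / 64 < dist ξ (z i) → ε₀ / 64 < dist ξ (-z i) →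
        𝓕 (Literature.Analysis.FunctionSpaces.EuclideanSpace.complexify ∘ ⇑(φ i)) ξ = 0) ∧
      ε₀ / 20 ≤ |‖z 0‖ - ‖z 1‖|)
    (fun φ ⟨z, h1, h2, h3⟩ => basicSplitForm_noDil hε₀ (hle.trans (min_le_left _ _))
      (hle.trans (min_le_right _ _)) H φ z h1 h2 h3)
    c ψ (fun j => ⟨ζ j, fun i => hann j i, fun i => hball j i, hgap j⟩) hT

end Summit.NavierStokesRegularity.NavierStokesRegularity.Theorems.SplitCascadeIsAveragedNoDil.Split

end
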